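import Summits.BirchSwinnertonDyer.BirchSwinnertonDyer.Theorems.PrintCf2SplitBadTwoRestrictedSelmerFiniteOfShaOfEtale
import Summits.BirchSwinnertonDyer.BirchSwinnertonDyer.Theorems.PrintCf2SplitBadTwoRestrictedSelmerConjTransportFrame
import Literature.NumberTheory.EllipticCurves.KatoTwistedFinitenessKummerDescentProofs
import Literature.NumberTheory.EllipticCurves.IwasawaSelmerProofs
import HarnessLib

/-!
# Crux `PrintCf2.SplitBadTwoRankOneOfFacts` (stmt-BirchSwinnertonDyer-20368), road α v11, (BF) «`Ш` finite ⟹ `𝔖_{v̄}(K, W*)` finite»,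
# part 5: THE ÉTALE BRICK TRAVELS ALONG COMPLEX CONJUGATION — (ET-v) ⟹ (ET-v̄), hence (FIN) from (ET-v)

Cell `bsd-print-cf2`, EXTRA WIDTH seat `bsd-line-cf2-p1-w4` g10 (prover-bsd-line-cf2-p1-w4-g10-0); `--supports stmt-BirchSwinnertonDyer-20368`
(helper, Theses-free). HONEST FRAMING: nothing here closes the crux or a registered stub; BSD is not proved by any of this; no summit
`Statement.lean` is touched; no `sorry`, no new axiom, no Literature fact, no definition.

Notation: `E := W.baseChange K` (`W/ℚ` elliptic), `K` imaginary quadratic with `2 = v·v̄`, `π ∈ End_K(E)` with `π² = π − 2`, `r ∈ ℤ₂`,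
`W* := E[𝔮_r^∞] = endEigenPrimaryTorsion 2 π r`, `W*′ := E[𝔮_{1−r}^∞]`, `κ_n` the level-`2^n` Kummer map, `res_⊤` the passage to `H¹(⊤, ·)`.

## What is proved

LEAD RULING (R-ET) (2026-08-29T00:38:07Z) has -w3 g10 prove the étale brick AT `v`:
(ET-v) «for every equivariant projector `e` onto `W*` killing `W*′`, every `K`-point `Q`, every `n`: `2 • res_{D_v}(e_* res_⊤ κ_n(Q)) = 0`»,
while part 4 of this series (`RelaxationLift.not_comap_kummer_le_ker_of_etale`) consumes the brick AT `v̄` for the OTHER summand: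
(ET-v̄) «for every equivariant projector `e′` onto `W*′` killing `W*`, every `Q′`, every `n`: `2 • res_{D_v̄}(e′_* res_⊤ κ_n(Q′)) = 0`».

* `two_nsmul_resOfLe_proj_kummer_conj` — **(ET-v) ⟹ (ET-v̄)** for ANY `r` (no root relation, no pinning, hfin-free). PROOF (transport of
  structure along a lift `τ` of complex conjugation `c`): -w2 g8's anti-commuting lift (`CMPrimes.exists_transport_anticommute`: `π ∘ τ =
  τ ∘ (1 − π)`) has `c ≠ 1` (`ConjTransport.ne_one_of_isLiftOfAut_of_anticommute`), so `c·v = v̄` (`LineDecomposition.eq_or_eq_smul_of_natCast_mem`);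
  `τ` maps `W*` onto `W*′` and `τ⁻¹` maps `W*′` onto `W*` compatibly with `g ↦ τ∓¹gτ^{±1}` (-w2 g10's
  `ConjTransport.exists_addMonoidHom_endEigenPrimaryTorsion_of_anticommute`). Given `e′`, the pulled-back map `e := τ⁻¹ ∘ e′ ∘ τ` is an
  equivariant projector onto `W*` killing `W*′`; (ET-v) for `e` and `Q := c⁻¹Q′` says the class `x := 2 • e_* res_⊤ κ_n(Q)` dies on `D_v`,
  hence on every conjugate `tD_vt⁻¹` (inner automorphisms act trivially on `H¹(Γ_K, ·)`, Literature `conjH1_of_mem_holds`); the transport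
  `T := (τ⁻¹·τ, τ|)_*` carries this to «`T x` dies on `D_v̄`» (-w2 g10's `ConjTransport.forall_resOfLe_conjH1_resH1Hom_eq_zero` with the place
  clause `τ⁻¹ D_v̄ τ ≤ t D_v t⁻¹`, `ConjTransport.exists_conjGalCMH_decomp_mem_conj_decomp`); finally `T(e_* res_⊤ κ_n(Q)) = e′_* res_⊤ κ_n(Q′)`
  because the Kummer map is `Aut(K/ℚ)`-equivariant (Literature `conjH1Primary_kummerMapLevel`: `τ_* κ_n(Q) = κ_n(cQ)`) and `τ ∘ e = e′ ∘ τ`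
  on `E[2^∞]` (functoriality `resH1Hom_comp`, `resH1Hom_comp_resSubgroup`).
* `not_comap_kummer_le_ker_of_etale_at_v` — (ET-v) ⟹ (MW-v̄) (part 4 ∘ the transport; needs `r² = r − 2`, `P` of infinite order).
* `finite_restrictedSelmerBase_of_finite_sha_of_etale_at_v` — **(FIN) of the v11 cut** (cf2c-w3 g0's `hFIN` binder order VERBATIM) with ONE
  trailing hypothesis: (ET-v) in the EXACT text of -w3 g10's `CMPrimes.cmScalar_localPoints_of_frame_of_etale` (hypothesis `hET`). So the moment
  `hET_holds` lands at `v`, `hFIN := fun d … hlog ↦ finite_restrictedSelmerBase_of_finite_sha_of_etale_at_v d … hlog (hET_holds …)`.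

[cite: GrossLMS1991, §5 (5.1)] [cite: SerreGaloisCohomology1997, I.§2.4–2.5] [cite: SerreLocalFields1979, VII.§5 Prop. 3]
[cite: NeukirchSchmidtWingberg2008, I §5] [cite: GreenbergLNM1716, §2 Props. 2.1–2.2] [cite: Agboola2007, §6 Props. 6.10–6.12, Thm. 6.12]
-/

noncomputable section

set_option linter.dupNamespace false

open scoped Classical Pointwise
open scoped TensorProduct

open CategoryTheory Function Field NumberField IsDedekindDomain WeierstrassCurve
open Literature.NumberTheory.EllipticCurves Literature.NumberTheory.EllipticCurves.GreenbergSelmer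
open Literature.NumberTheory.EllipticCurves.Agboola2007
open Literature.NumberTheory.EllipticCurves.ResKernel
open Literature.NumberTheory.GaloisRepresentations
open Literature.NumberTheory.GaloisCohomology
open scoped ContRepresentation
open Summit.BirchSwinnertonDyer.Rank1Residual.X11b
open Summit.BirchSwinnertonDyer.BirchSwinnertonDyer.Theorems.PrintCf2.RestrictedSelmerPair
open Summit.BirchSwinnertonDyer.BirchSwinnertonDyer.Theorems.PrintCf2.AdditiveAtSeven
open Summit.BirchSwinnertonDyer.BirchSwinnertonDyer.Theorems.GoldfeldGoodTwists
open Summit.BirchSwinnertonDyer.BirchSwinnertonDyer.Theorems.PrintCf2.CMPrimes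
open Summit.BirchSwinnertonDyer.BirchSwinnertonDyer.Theorems.PrintCf2.ConjTransport

namespace Summit.BirchSwinnertonDyer.BirchSwinnertonDyer.Theorems.PrintCf2.RelaxationLift

variable {K : Type} [Field K] [NumberField K]

/-! ## §1. (ET-v) ⟹ (ET-v̄): transport along a lift of complex conjugation -/

set_option maxHeartbeats 400000 in
/-- **The étale brick travels along complex conjugation: (ET-v) ⟹ (ET-v̄).** `W/ℚ` elliptic, `K` imaginary quadratic with `2 = v·v̄`,
`π ∈ End_K(E)` with `π² = π − 2`, `r ∈ ℤ₂` arbitrary. IF for every equivariant projector `e` onto `W* = E[𝔮_r^∞]` killing `W*′ = E[𝔮_{1−r}^∞]`,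
every `K`-point `Q` and every `n` the class `2 • res_{⊤ ⊓ D_v}(e_* res_⊤ κ_n(Q))` vanishes, THEN for every equivariant projector `e′` onto `W*′`
killing `W*`, every `Q′` and every `n` the class `2 • res_{⊤ ⊓ D_v̄}(e′_* res_⊤ κ_n(Q′))` vanishes. Transport of structure along -w2 g8's
anti-commuting lift `τ` of complex conjugation (`e := τ⁻¹ e′ τ`, `Q := c⁻¹ Q′`, `τ_* κ_n(Q) = κ_n(cQ)`, `τ⁻¹ D_v̄ τ ≤ t D_v t⁻¹`, inner automorphisms
trivial on `H¹(Γ_K, ·)`). [cite: GrossLMS1991, §5 (5.1)] [cite: SerreGaloisCohomology1997, I.§2.4–2.5] [cite: SerreLocalFields1979, VII.§5 Prop. 3]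
[cite: NeukirchSchmidtWingberg2008, I §5] -/
theorem two_nsmul_resOfLe_proj_kummer_conj (W : WeierstrassCurve ℚ) [W.IsElliptic] (hK : IsImaginaryQuadratic K)
    {v vbar : HeightOneSpectrum (𝓞 K)} (hv : ((2 : ℕ) : 𝓞 K) ∈ v.asIdeal) (hvbar : ((2 : ℕ) : 𝓞 K) ∈ vbar.asIdeal) (hne : vbar ≠ v)
    (π : (W.baseChange K).endRing) (hrel : (π : AddMonoid.End (W.baseChange K).geomPoints) * π = π - 2) (r : ℤ_[2])
    (hET : ∀ (e : (W.baseChange K).geomPrimaryTorsion 2 →+ ↥((W.baseChange K).endEigenPrimaryTorsion 2 π r))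
        (_ : ∀ x : ↥((W.baseChange K).endEigenPrimaryTorsion 2 π r), e x = x)
        (_ : ∀ x ∈ (W.baseChange K).endEigenPrimaryTorsion 2 π (1 - r), e x = 0)
        (he : ∀ (σ : absoluteGaloisGroup K) (x : (W.baseChange K).geomPrimaryTorsion 2), e (σ • x) = σ • e x)
        (Q : (W.baseChange K).toAffine.Point) (n : ℕ),
        2 • resOfLe ↥((W.baseChange K).endEigenPrimaryTorsion 2 π r) (inf_le_left : ⊤ ⊓ decomp v ≤ ⊤)
          (resH1Hom (ContinuousMonoidHom.id (⊤ : Subgroup (absoluteGaloisGroup K))) e (fun σ x ↦ he σ x)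
            (resSubgroup ⊤ ((W.baseChange K).geomPrimaryTorsion 2)
              ((W.baseChange K).kummerMapLevel 2 (W.baseChange K).zsmul_geomPoints_surjective_holds n Q))) = 0)
    (e' : (W.baseChange K).geomPrimaryTorsion 2 →+ ↥((W.baseChange K).endEigenPrimaryTorsion 2 π (1 - r)))
    (he'₁ : ∀ x : ↥((W.baseChange K).endEigenPrimaryTorsion 2 π (1 - r)), e' x = x)
    (he'0 : ∀ x ∈ (W.baseChange K).endEigenPrimaryTorsion 2 π r, e' x = 0)
    (he' : ∀ (σ : absoluteGaloisGroup K) (x : (W.baseChange K).geomPrimaryTorsion 2), e' (σ • x) = σ • e' x)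
    (Q' : (W.baseChange K).toAffine.Point) (n : ℕ) :
    2 • resOfLe ↥((W.baseChange K).endEigenPrimaryTorsion 2 π (1 - r)) (inf_le_left : ⊤ ⊓ decomp vbar ≤ ⊤)
      (resH1Hom (ContinuousMonoidHom.id (⊤ : Subgroup (absoluteGaloisGroup K))) e' (fun σ x ↦ he' σ x)
        (resSubgroup ⊤ ((W.baseChange K).geomPrimaryTorsion 2)
          ((W.baseChange K).kummerMapLevel 2 (W.baseChange K).zsmul_geomPoints_surjective_holds n Q'))) = 0 := by
  haveI : Fact (Nat.Prime 2) := ⟨Nat.prime_two⟩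
  haveI : Algebra.IsQuadraticExtension ℚ K := ⟨hK.1⟩
  haveI : IsGalois ℚ K := inferInstance
  haveI : (W.baseChange K).IsElliptic := by rw [baseChange]; infer_instance
  -- the anti-commuting lift `τ` of complex conjugation `c`
  obtain ⟨σ₀, hτ, hanti⟩ := exists_transport_anticommute W K π hrel
  set c : K ≃ₐ[ℚ] K := (absGaloisTransportRat K σ₀).restrictNormal K with hc_def
  have hc : c ≠ 1 := ne_one_of_isLiftOfAut_of_anticommute W K hτ π hanti
  have hcv : c • v = vbar := (LineDecomposition.eq_or_eq_smul_of_natCast_mem hK.1 hc Nat.prime_two hv hvbar hne).2.2.1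
  have h𝔮 : c⁻¹ • vbar = v := inv_smul_eq_iff.mpr hcv.symm
  have hτ' := hτ.symm_isLiftOfAut
  have hanti' := pointsMap_symm_anticommute W K hτ hanti
  -- the place clause: `τ⁻¹ D_v̄ τ ≤ t D_v t⁻¹`
  obtain ⟨T, hT⟩ := exists_ringHom_coe_eq_absGaloisTransport (K := K) σ₀
  obtain ⟨t, ht⟩ := exists_conjGalCMH_decomp_mem_conj_decomp hτ T hT vbar
  rw [h𝔮] at ht
  -- the Galois side on `⊤`
  obtain ⟨Φ, hΦ⟩ := exists_topHom (G := absoluteGaloisGroup K) hτ.conjGalCMH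
  -- the coefficient sides: `Ψ = τ` on `E[2^∞]` (kept opaque), `ψ = τ| : W* → W*′`, `ψ' = τ⁻¹| : W*′ → W*`, `ψ₂ = τ| : W*′ → W*`
  obtain ⟨Ψ, hΨ⟩ : ∃ Ψ : (W.baseChange K).geomPrimaryTorsion 2 →+ (W.baseChange K).geomPrimaryTorsion 2, Ψ = hτ.primaryTorsionMap W 2 := ⟨_, rfl⟩
  have hΨsmul : ∀ (g : absoluteGaloisGroup K) (m : (W.baseChange K).geomPrimaryTorsion 2), Ψ (hτ.conjGalCMH g • m) = g • Ψ m := fun g m ↦ by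
    rw [hΨ]; exact hτ.primaryTorsionMap_smul W 2 g m
  have hΨcoe : ∀ m : (W.baseChange K).geomPrimaryTorsion 2, ((Ψ m : (W.baseChange K).geomPrimaryTorsion 2) : (W.baseChange K).geomPoints) = hτ.pointsMap W (m : (W.baseChange K).geomPoints) :=
    fun m ↦ by rw [hΨ]; rfl
  obtain ⟨ψ, hψpt, hψ⟩ := exists_addMonoidHom_endEigenPrimaryTorsion_of_anticommute W K hτ π hanti (ρ := r) (ρ' := 1 - r) rfl
  obtain ⟨ψ', hψ'pt, hψ'⟩ := exists_addMonoidHom_endEigenPrimaryTorsion_of_anticommute W K hτ' π hanti' (ρ := 1 - r) (ρ' := r)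
    (sub_sub_cancel 1 r).symm
  obtain ⟨ψ₂, hψ₂pt, -⟩ := exists_addMonoidHom_endEigenPrimaryTorsion_of_anticommute W K hτ π hanti (ρ := 1 - r) (ρ' := r)
    (sub_sub_cancel 1 r).symm
  -- coercion formulas and round trips
  have hΨψ : ∀ x : ↥((W.baseChange K).endEigenPrimaryTorsion 2 π r), Ψ (x : (W.baseChange K).geomPrimaryTorsion 2) = ((ψ x : ↥((W.baseChange K).endEigenPrimaryTorsion 2 π (1 - r))) : (W.baseChange K).geomPrimaryTorsion 2) := fun x ↦
    Subtype.ext (by rw [hΨcoe, hψpt])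
  have hΨψ₂ : ∀ x : ↥((W.baseChange K).endEigenPrimaryTorsion 2 π (1 - r)), Ψ (x : (W.baseChange K).geomPrimaryTorsion 2) = ((ψ₂ x : ↥((W.baseChange K).endEigenPrimaryTorsion 2 π r)) : (W.baseChange K).geomPrimaryTorsion 2) := fun x ↦
    Subtype.ext (by rw [hΨcoe, hψ₂pt])
  have hψ'ψ : ∀ x : ↥((W.baseChange K).endEigenPrimaryTorsion 2 π r), ψ' (ψ x) = x := fun x ↦
    Subtype.ext (Subtype.ext (by rw [hψ'pt, hψpt, pointsMap_symm_pointsMap W K hτ]))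
  have hψψ' : ∀ z : ↥((W.baseChange K).endEigenPrimaryTorsion 2 π (1 - r)), ψ (ψ' z) = z := fun z ↦
    Subtype.ext (Subtype.ext (by rw [hψpt, hψ'pt, pointsMap_pointsMap_symm W K hτ]))
  -- the pulled-back projector `e := τ⁻¹ ∘ e′ ∘ τ` (kept opaque)
  obtain ⟨e, he_def⟩ : ∃ e : (W.baseChange K).geomPrimaryTorsion 2 →+ ↥((W.baseChange K).endEigenPrimaryTorsion 2 π r), e = ψ'.comp (e'.comp Ψ) := ⟨_, rfl⟩
  have he_apply : ∀ x, e x = ψ' (e' (Ψ x)) := fun x ↦ by rw [he_def]; rfl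
  have he₁ : ∀ x : ↥((W.baseChange K).endEigenPrimaryTorsion 2 π r), e x = x := fun x ↦ by
    rw [he_apply, hΨψ, he'₁, hψ'ψ]
  have he0 : ∀ x ∈ (W.baseChange K).endEigenPrimaryTorsion 2 π (1 - r), e x = 0 := fun x hx ↦ by
    have hmem : Ψ x ∈ (W.baseChange K).endEigenPrimaryTorsion 2 π r := by
      rw [show x = ((⟨x, hx⟩ : ↥((W.baseChange K).endEigenPrimaryTorsion 2 π (1 - r))) : (W.baseChange K).geomPrimaryTorsion 2) from rfl, hΨψ₂]
      exact (ψ₂ ⟨x, hx⟩).2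
    rw [he_apply, he'0 _ hmem, map_zero]
  have he : ∀ (σ : absoluteGaloisGroup K) (x : (W.baseChange K).geomPrimaryTorsion 2), e (σ • x) = σ • e x := fun σ x ↦ by
    rw [he_apply, he_apply]
    conv_lhs => rw [← conjGalCMH_symm_conjGalCMH K hτ σ]
    rw [hΨsmul, he', hψ']
  -- the pulled-back point `Q := c⁻¹ Q′` (kept opaque)
  obtain ⟨Q, hQ⟩ : ∃ Q : (W.baseChange K).toAffine.Point, Affine.Point.map (W' := W.toAffine) (c : K →ₐ[ℚ] K) Q = Q' :=
    ⟨Affine.Point.map (W' := W.toAffine) (c.symm : K →ₐ[ℚ] K) Q', by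
      rw [Affine.Point.map_map, AlgEquiv.comp_symm]
      cases Q' <;> rfl⟩
  -- (ET-v) for `(e, Q, n)`: the class `x` below (kept opaque) has `res_{⊤ ⊓ D_v} (2 • x) = 0`
  obtain ⟨x, hx_def⟩ : ∃ x : subgroupH1 (⊤ : Subgroup (absoluteGaloisGroup K)) ↥((W.baseChange K).endEigenPrimaryTorsion 2 π r),
      x = resH1Hom (ContinuousMonoidHom.id (⊤ : Subgroup (absoluteGaloisGroup K))) e (fun σ x ↦ he σ x) (resSubgroup ⊤ ((W.baseChange K).geomPrimaryTorsion 2) ((W.baseChange K).kummerMapLevel 2 (W.baseChange K).zsmul_geomPoints_surjective_holds n Q)) := ⟨_, rfl⟩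
  have hx0 : resOfLe ↥((W.baseChange K).endEigenPrimaryTorsion 2 π r) (inf_le_left : (⊤ : Subgroup (absoluteGaloisGroup K)) ⊓ decomp v ≤ ⊤) (2 • x) = 0 := by
    rw [map_nsmul, hx_def]; exact hET e he₁ he0 he Q n
  -- transport along `(Φ, ψ)`: `res_{⊤ ⊓ D_v̄} (T (2 • x)) = 0`
  have hcompat : ∀ (g : (⊤ : Subgroup (absoluteGaloisGroup K))) (m : ↥((W.baseChange K).endEigenPrimaryTorsion 2 π r)), ψ (Φ g • m) = g • ψ m := fun g m ↦ by
    rw [Subgroup.smul_def, Subgroup.smul_def, hΦ]; exact hψ g m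
  have hD : ∀ g : (⊤ : Subgroup (absoluteGaloisGroup K)), (g : absoluteGaloisGroup K) ∈ decomp vbar →
      ((Φ g : (⊤ : Subgroup (absoluteGaloisGroup K))) : absoluteGaloisGroup K) ∈ MulAut.conj t • decomp v := fun g hg ↦ by
    rw [hΦ]; exact ht _ hg
  have hall : ∀ s : absoluteGaloisGroup K, resOfLe ↥((W.baseChange K).endEigenPrimaryTorsion 2 π r) (inf_le_left : (⊤ : Subgroup (absoluteGaloisGroup K)) ⊓ decomp v ≤ ⊤)
      (conjH1 (⊤ : Subgroup (absoluteGaloisGroup K)) ↥((W.baseChange K).endEigenPrimaryTorsion 2 π r) s (2 • x)) = 0 := fun s ↦ by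
    rw [Literature.NumberTheory.EllipticCurves.conjH1_of_mem_holds (⊤ : Subgroup (absoluteGaloisGroup K)) ↥((W.baseChange K).endEigenPrimaryTorsion 2 π r) (Subgroup.mem_top s),
      AddMonoidHom.id_apply]
    exact hx0
  have key := forall_resOfLe_conjH1_resH1Hom_eq_zero Φ ψ hcompat (D := decomp vbar) (D' := decomp v) t hD hall 1
  rw [Literature.NumberTheory.EllipticCurves.conjH1_of_mem_holds (⊤ : Subgroup (absoluteGaloisGroup K)) ↥((W.baseChange K).endEigenPrimaryTorsion 2 π (1 - r))
      (Subgroup.mem_top (1 : absoluteGaloisGroup K)), AddMonoidHom.id_apply, map_nsmul, map_nsmul] at key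
  -- identify `T x = e′_* res_⊤ κ_n(Q′)`
  have hcompatΨ : ∀ (g : (⊤ : Subgroup (absoluteGaloisGroup K))) (m : (W.baseChange K).geomPrimaryTorsion 2), Ψ (Φ g • m) = g • Ψ m :=
    fun g m ↦ by rw [Subgroup.smul_def, Subgroup.smul_def, hΦ]; exact hΨsmul g m
  have hmod : ψ.comp e = e'.comp Ψ := by
    ext y
    rw [AddMonoidHom.comp_apply, AddMonoidHom.comp_apply, he_apply, hψψ']
  have hconj : hτ.conjH1Primary W 2 = resH1Hom hτ.conjGalCMH Ψ hΨsmul := by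
    rw [IsLiftOfAut.conjH1Primary]
    exact resH1Hom_congr rfl hΨ.symm _ _
  have hkum : resSubgroup ⊤ ((W.baseChange K).geomPrimaryTorsion 2) ((W.baseChange K).kummerMapLevel 2 (W.baseChange K).zsmul_geomPoints_surjective_holds n Q') = resH1Hom Φ Ψ hcompatΨ (resSubgroup ⊤ ((W.baseChange K).geomPrimaryTorsion 2) ((W.baseChange K).kummerMapLevel 2 (W.baseChange K).zsmul_geomPoints_surjective_holds n Q)) := by
    rw [← hQ, ← conjH1Primary_kummerMapLevel W 2 (W.baseChange K).zsmul_geomPoints_surjective_holds hτ n Q, hconj]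
    have hsq := resH1Hom_comp_resSubgroup hτ.conjGalCMH Ψ hΨsmul ⊤ ⊤ Φ hΦ hcompatΨ
    have happ := congrArg (fun f ↦ f ((W.baseChange K).kummerMapLevel 2 (W.baseChange K).zsmul_geomPoints_surjective_holds n Q)) hsq
    simp only [AddMonoidHom.comp_apply] at happ
    rw [happ]
  have hφ : (ContinuousMonoidHom.id (⊤ : Subgroup (absoluteGaloisGroup K))).comp Φ = Φ.comp (ContinuousMonoidHom.id (⊤ : Subgroup (absoluteGaloisGroup K))) := by
    ext; rfl
  have hmaps : (resH1Hom Φ ψ hcompat).comp (resH1Hom (ContinuousMonoidHom.id (⊤ : Subgroup (absoluteGaloisGroup K))) e (fun σ x ↦ he σ x)) =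
      (resH1Hom (ContinuousMonoidHom.id (⊤ : Subgroup (absoluteGaloisGroup K))) e' (fun σ x ↦ he' σ x)).comp (resH1Hom Φ Ψ hcompatΨ) := by
    rw [resH1Hom_comp, resH1Hom_comp]
    exact resH1Hom_congr hφ hmod _ _
  have hident : resH1Hom Φ ψ hcompat x =
      resH1Hom (ContinuousMonoidHom.id (⊤ : Subgroup (absoluteGaloisGroup K))) e' (fun σ x ↦ he' σ x) (resSubgroup ⊤ ((W.baseChange K).geomPrimaryTorsion 2) ((W.baseChange K).kummerMapLevel 2 (W.baseChange K).zsmul_geomPoints_surjective_holds n Q')) := by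
    rw [hkum, hx_def]
    exact DFunLike.congr_fun hmaps _
  rw [hident] at key
  exact key

/-! ## §2. (MW-v̄) and (FIN) from the étale brick AT `v` -/

/-- **(ET-v) ⟹ (MW-v̄)** on the frame (`C • W = cm7^{(d)}`, `K` imaginary quadratic with `2 = v·v̄`, `π² = π − 2`, `r² = r − 2`, `P ∈ W(ℚ)` of
infinite order), with (ET-v) in the EXACT text of -w3 g10's `CMPrimes.cmScalar_localPoints_of_frame_of_etale` (hypothesis `hET`): part 4's
`not_comap_kummer_le_ker_of_etale` after the transport `two_nsmul_resOfLe_proj_kummer_conj`.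
[cite: GreenbergLNM1716, §2 Props. 2.1–2.2] [cite: GrossLMS1991, §5 (5.1)] [cite: Agboola2007, §6 Prop. 6.11 (arXiv p0014)] -/
theorem not_comap_kummer_le_ker_of_etale_at_v {d : ℤ} (hd0 : d ≠ 0) (W : WeierstrassCurve ℚ) [W.IsElliptic]
    (C : VariableChange ℚ) (hC : C • W = cm7.quadraticTwist (d : ℚ)) (hK : IsImaginaryQuadratic K)
    {v vbar : HeightOneSpectrum (𝓞 K)} (hv : ((2 : ℕ) : 𝓞 K) ∈ v.asIdeal) (hvbar : ((2 : ℕ) : 𝓞 K) ∈ vbar.asIdeal) (hne : vbar ≠ v)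
    (π : (W.baseChange K).endRing) (hrel : (π : AddMonoid.End (W.baseChange K).geomPoints) * π = π - 2) {r : ℤ_[2]} (hr : r * r = r - 2)
    {P : W.toAffine.Point} (hP : ¬ IsOfFinAddOrder P)
    (hET : ∀ (e : (W.baseChange K).geomPrimaryTorsion 2 →+ ↥((W.baseChange K).endEigenPrimaryTorsion 2 π r))
        (_ : ∀ x : ↥((W.baseChange K).endEigenPrimaryTorsion 2 π r), e x = x)
        (_ : ∀ x ∈ (W.baseChange K).endEigenPrimaryTorsion 2 π (1 - r), e x = 0)
        (he : ∀ (σ : absoluteGaloisGroup K) (x : (W.baseChange K).geomPrimaryTorsion 2), e (σ • x) = σ • e x)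
        (Q : (W.baseChange K).toAffine.Point) (n : ℕ),
        2 • resOfLe ↥((W.baseChange K).endEigenPrimaryTorsion 2 π r) (inf_le_left : ⊤ ⊓ decomp v ≤ ⊤)
          (resH1Hom (ContinuousMonoidHom.id (⊤ : Subgroup (absoluteGaloisGroup K))) e (fun σ x ↦ he σ x)
            (resSubgroup ⊤ ((W.baseChange K).geomPrimaryTorsion 2)
              ((W.baseChange K).kummerMapLevel 2 (W.baseChange K).zsmul_geomPoints_surjective_holds n Q))) = 0) :
    ¬ (((((W.baseChange K).kummerMapPInfty 2 (W.baseChange K).zsmul_geomPoints_surjective_holds).range).map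
          (resSubgroup ⊤ ((W.baseChange K).geomPrimaryTorsion 2))).comap
            (resH1Hom (ContinuousMonoidHom.id _) ((W.baseChange K).endEigenPrimaryTorsion 2 π r).subtype (fun _ _ ↦ rfl)) ≤
        (resOfLe ↥((W.baseChange K).endEigenPrimaryTorsion 2 π r) (@inf_le_left _ _ (⊤ : Subgroup (absoluteGaloisGroup K)) (decomp vbar))).ker) :=
  not_comap_kummer_le_ker_of_etale hd0 W C hC hK hv hvbar hne π hrel hr hP
    (fun e' he'₁ he'0 he' Q' n ↦ two_nsmul_resOfLe_proj_kummer_conj W hK hv hvbar hne π hrel r hET e' he'₁ he'0 he' Q' n)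

/-- **(FIN) of the v11 cut from the étale brick AT `v`**: the binders of cf2c-w3 g0's `hFIN` (`restrictedMainConj_two_v11_of_finiteOfSha_of_twistPush`)
VERBATIM — member block with `Finite W.sha`, then `K, v, v̄`, then `π hπ r hr hpin`, then `P c₀ ℓ hP hgen hc₀ hker hlog` — followed by ONE trailing
hypothesis, (ET-v) in the EXACT text of -w3 g10's `hET`, conclude `Finite 𝔖_{v̄}(K, W*)`. Chain: `Finite W.sha ⟹ Finite Ш(W_K)[2^∞]`;
(ET-v) ⟹ (ET-v̄) ⟹ (MW-v̄); part 3. [cite: Agboola2007, §6 Thm. 6.12 (arXiv p0015)] [cite: GrossLMS1991, §5 (5.1)] [cite: GreenbergLNM1716, §2 Props. 2.1–2.2] -/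
theorem finite_restrictedSelmerBase_of_finite_sha_of_etale_at_v :
    ∀ (d : ℤ), d ≠ 0 → Squarefree d → d % 4 ≠ 1 →
      ∀ (W : WeierstrassCurve ℚ) [W.IsElliptic] [W.IsGloballyMinimal] (C : VariableChange ℚ),
        C • W = cm7.quadraticTwist (d : ℚ) → W.analyticRank = 1 →
        Finite W.sha →
      ∀ (K : Type) [Field K] [NumberField K], IsImaginaryQuadratic K →
      ∀ (v vbar : HeightOneSpectrum (𝓞 K)),
        ((2 : ℕ) : 𝓞 K) ∈ v.asIdeal → ((2 : ℕ) : 𝓞 K) ∈ vbar.asIdeal → vbar ≠ v →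
      ∀ (π : (W.baseChange K).endRing), (π : AddMonoid.End (W.baseChange K).geomPoints) * π = π - 2 →
      ∀ (r : ℤ_[2]), r * r = r - 2 →
        (∀ τ ∈ GreenbergSelmer.inertia v, ∀ x : ↥((W.baseChange K).endEigenPrimaryTorsion 2 π r), τ • x = x ∨ τ • x = -x) →
      ∀ (P : W.toAffine.Point) (c₀ : ℕ) (ℓ : ℤ),
        ¬ IsOfFinAddOrder P →
        (∀ R : W.toAffine.Point, ∃ (k : ℤ) (T : W.toAffine.Point), IsOfFinAddOrder T ∧ R = k • P + T) →
        c₀ ≠ 0 → (W.baseChange ℚ_[2]).IsInReductionKernel (c₀ • W.toPadicPoint 2 P) →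
        ‖(W.baseChange ℚ_[2]).padicLogPoint (c₀ • W.toPadicPoint 2 P) / (c₀ : ℚ_[2])‖ = (2 : ℝ) ^ (-ℓ) →
      (∀ (e : (W.baseChange K).geomPrimaryTorsion 2 →+ ↥((W.baseChange K).endEigenPrimaryTorsion 2 π r))
        (_ : ∀ x : ↥((W.baseChange K).endEigenPrimaryTorsion 2 π r), e x = x)
        (_ : ∀ x ∈ (W.baseChange K).endEigenPrimaryTorsion 2 π (1 - r), e x = 0)
        (he : ∀ (σ : absoluteGaloisGroup K) (x : (W.baseChange K).geomPrimaryTorsion 2), e (σ • x) = σ • e x)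
        (Q : (W.baseChange K).toAffine.Point) (n : ℕ),
        2 • resOfLe ↥((W.baseChange K).endEigenPrimaryTorsion 2 π r) (inf_le_left : ⊤ ⊓ decomp v ≤ ⊤)
          (resH1Hom (ContinuousMonoidHom.id (⊤ : Subgroup (absoluteGaloisGroup K))) e (fun σ x ↦ he σ x)
            (resSubgroup ⊤ ((W.baseChange K).geomPrimaryTorsion 2)
              ((W.baseChange K).kummerMapLevel 2 (W.baseChange K).zsmul_geomPoints_surjective_holds n Q))) = 0) →
      Finite (restrictedSelmerBase ↥((W.baseChange K).endEigenPrimaryTorsion 2 π r) 2 vbar) := by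
  intro d hd0 hsq hd4 W _ _ C hC hrank hsha K _ _ hK v vbar hv hvbar hne π hrel r hr hpin P c₀ ℓ hP hgen hc₀ hker hlog hET
  exact finite_restrictedSelmerBase_of_finite_sha_of_etale d hd0 hsq hd4 W C hC hrank hsha K hK v vbar hv hvbar hne π hrel r hr hpin P c₀ ℓ
    hP hgen hc₀ hker hlog (fun e' he'₁ he'0 he' Q' n ↦ two_nsmul_resOfLe_proj_kummer_conj W hK hv hvbar hne π hrel r hET e' he'₁ he'0 he' Q' n)

end Summit.BirchSwinnertonDyer.BirchSwinnertonDyer.Theorems.PrintCf2.RelaxationLift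

end
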